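import Summits.NavierStokesRegularity.FluidComputer.ModulatedCollapseGaugeRigidity
import Summits.NavierStokesRegularity.FluidComputer.PeriodicReadoutClock
import HarnessLib

/-!
# A discretely self-similar profile in an ARBITRARY clock is discretely self-similar in Leray's clock:
# the momentum equation makes the readout periodic — no logarithmic correction on an exact DSS object

Summit `NavierStokesRegularity`, cell topic directory `FluidComputer`, namespace
`…FluidComputer.SelfSimilarCensus`; zone Z7 of the D-0081 profile search («generalised self-similar with
logarithmic correction (DSS / log-periodic ansatz)»). DSS-side twin of `ModulatedCollapseGaugeRigidity.lean`
(STEADY profile in any clock ⇒ Leray's clock exactly), which names the similarity-time dependent profile as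
not treated; the clock algebra is `PeriodicReadoutClock.lean`. PROVED theorems only; no definitions, no
named facts.

## Setting (similarity time `σ` primary; `E` a finite-dimensional real inner product space; any `ν : ℝ`)

A clock `(ℓ, θ)` on similarity times `σ`: velocity scale `ℓ(σ) ≠ 0` with derivative `ℓ′`, physical time
`θ(σ)` with `θ′ = ℓ⁻²`. A profile `W : ℝ → E → E`, `(σ, y) ↦ W σ y`, jointly `C¹`, and a similarity
pressure `Q : ℝ → E → ℝ`. The physical fields along the clock are the modulated ansatz
`u(θ(σ), x) = ℓ(σ) • W(σ, ℓ(σ) • x)` (`= nsRescaleData (ℓ σ) (W σ) x`), `p(θ(σ), x) = ℓ(σ)² Q(σ, ℓ(σ) • x)`.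
EVERY field `u` on the clock's time range can be written so, for EVERY clock; the hypothesis with content
is PERIODICITY IN THIS CLOCK: `W(σ + P) = W(σ)`, `Q(σ + P) = Q(σ)`.

## Content

* §1–§2 `hasDerivAt_modulatedProfile`, `timeDeriv_along_clock`, `momentum_modulatedProfile`: at `(θ(σ), x)`,
  `y = ℓ(σ) x`,
  `∂ₜu + (u·∇)u + ∇p − νΔu = ℓ²ℓ′ • (W + D_yW y)(σ, y) + ℓ³ • (∂_σW + (W·∇)W + ∇Q − νΔW)(σ, y)`
  (the `∂_σW = 0` case is `momentum_nsRescaleData` of the companion file).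
* §3 `twoTerm_of_momentum_profile`, `readout_add_period_eq`: if the momentum equation holds at the
  similarity times `σ` and `σ + P` and `W(σ, ·) ≢ 0`, the READOUT `ℓ′/ℓ = (log ℓ)′` takes the same value
  at `σ` and `σ + P` (one linear-independence step, `mul_eq_mul_of_twoTerm`; the degenerate branch
  `W + D_yW y ≡ 0` dies by `eq_zero_of_scalingGenerator_eq_zero`).
* §4 HEADLINES on an open half-line `σ > σ₀` (`ℓ > 0`, `P > 0`, `W(σ, ·) ≢ 0`):
  `periodicProfile_scaleFactor` — ONE `c > 0` with `ℓ(σ + P) = c ℓ(σ)` and the covariance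
  `u(θ(σ + P), x) = c • u(θ(σ), c • x)`; `periodicProfile_blowup_rigidity` — if the physical time is
  bounded (`θ → T`, the only branch a blow-up candidate lives on) then `c > 1`,
  `T − θ(σ + P) = (T − θ(σ))/c²`, `θ < T`, `u(T − (T − t)/c², x) = c • u(t, c • x)` on the clock's range
  (BACKWARD DSS with factor `c` in the PARABOLIC gauge about `(T, 0)`), and
  `0 < m ≤ (T − θ(σ)) ℓ(σ)² ≤ M`: the velocity scale is `(T − t)^{-1/2}` up to a bounded factor periodic
  in similarity time — NO logarithmic (or any secular) correction; `periodicProfile_nsRescale_eq` — with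
  `T = 0`, `nsRescale c u t = u t` at every clock time past one period (the tree's
  `IsDiscretelySelfSimilar` / `periodic_lerayOrbit_iff` class).
  READING for the Z7 row: the zone name's «and/or» is exclusive at the exact level — a log-PERIODIC
  modulation of Leray's gauge is plain DSS, a log-CORRECTION belongs to drifting (non-periodic) profiles.

WHAT THIS IS NOT: not a statement about which branch a Navier–Stokes evolution takes, not an existence or
non-existence claim for DSS profiles, not Navier–Stokes evidence; the differentiability of `t ↦ u(t, x)`
at the clock times and the pressure ansatz are hypotheses (as in every printed self-similar ansatz);
`violates:` none — no object. Tree search: `lean search 'periodic.*lerayOrbit|clock|modulat'` —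
`periodic_lerayOrbit_iff` (Leray's clock, kinematic), `ModulationReadout.*` (Leray's clock readout),
`momentum_nsRescaleData` (steady profile); nothing for a periodic profile in a general clock.

## References (context; the statements are folklore consequences of the scaling symmetry)

* J. Leray, Acta Math. 63 (1934), §20, (3.11)–(3.12). [Leray1934]
* D. Chae, J. Wolf, Arch. Rational Mech. Anal. 225 (2017), Def. 1.1, §4. [ChaeWolf2017RemovingDSS]
-/

noncomputable section

open Set Filter Topology InnerProductSpace Function
open scoped Laplacian RealInnerProductSpace

namespace Summit.NavierStokesRegularity.FluidComputer.SelfSimilarCensus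

open Literature.Analysis.FluidPDE

/-! ### §1 Calculus of a similarity-time dependent profile along a clock -/

section Calculus

variable {E : Type*} [NormedAddCommGroup E] [NormedSpace ℝ E]
variable {F : Type*} [NormedAddCommGroup F] [NormedSpace ℝ F]
variable {W : ℝ → E → F} {σ : ℝ} {y : E} {L : ℝ × E →L[ℝ] F}

/-- The similarity-time slice derivative from the joint derivative:
`∂_σ W(σ, y) = DW(σ, y)(1, 0)`. [folklore] -/
theorem hasDerivAt_slice_time (h : HasFDerivAt (uncurry W) L (σ, y)) :
    HasDerivAt (fun s => W s y) (L (1, 0)) σ := by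
  have hγ : HasDerivAt (fun s : ℝ => (s, y)) ((1 : ℝ), (0 : E)) σ :=
    (hasDerivAt_id σ).prodMk (hasDerivAt_const σ y)
  exact h.comp_hasDerivAt σ hγ

/-- The space slice derivative from the joint derivative: `D_y W(σ, ·)(y) w = DW(σ, y)(0, w)`. [folklore] -/
theorem hasFDerivAt_slice_space (h : HasFDerivAt (uncurry W) L (σ, y)) :
    HasFDerivAt (W σ) (L.comp (ContinuousLinearMap.inr ℝ ℝ E)) y :=
  h.comp y (hasFDerivAt_prodMk_right σ y)

/-- `fderiv` form of `hasFDerivAt_slice_space`. [folklore] -/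
theorem fderiv_slice_space_apply (h : HasFDerivAt (uncurry W) L (σ, y)) (w : E) :
    fderiv ℝ (W σ) y w = L (0, w) := by
  rw [(hasFDerivAt_slice_space h).fderiv, ContinuousLinearMap.comp_apply, ContinuousLinearMap.inr_apply]

/-- **The similarity-time line of the modulated ansatz with a `σ`-dependent profile.** For `ℓ`
differentiable at `σ` (derivative `ℓ′`) and `W` jointly differentiable at `(σ, y)`, `y = ℓ(σ) x`:
`d/dσ [ℓ(σ) • W(σ, ℓ(σ) • x)] = ℓ′ • (W(σ, y) + DW(σ, y)(0, y)) + ℓ(σ) • DW(σ, y)(1, 0)` — scaling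
generator times `ℓ′` plus `ℓ` times the profile's own time derivative. [folklore] -/
theorem hasDerivAt_modulatedProfile {ℓ : ℝ → ℝ} {ℓ' : ℝ} (x : E) (hℓ : HasDerivAt ℓ ℓ' σ)
    (hW : HasFDerivAt (uncurry W) L (σ, ℓ σ • x)) :
    HasDerivAt (fun s => ℓ s • W s (ℓ s • x))
      (ℓ' • (W σ (ℓ σ • x) + L (0, ℓ σ • x)) + ℓ σ • L (1, 0)) σ := by
  have hγ : HasDerivAt (fun s : ℝ => (s, ℓ s • x)) ((1 : ℝ), ℓ' • x) σ :=
    (hasDerivAt_id σ).prodMk (hℓ.smul_const x)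
  have h2 : HasDerivAt (fun s => W s (ℓ s • x)) (L (1, ℓ' • x)) σ := by
    have h := hW.comp_hasDerivAt σ hγ
    exact h
  refine (hℓ.smul h2).congr_deriv ?_
  have hsplit : ((1 : ℝ), ℓ' • x) = ((1 : ℝ), (0 : E)) + ℓ' • ((0 : ℝ), x) := by ext <;> simp
  have hy : ((0 : ℝ), ℓ σ • x) = ℓ σ • ((0 : ℝ), x) := by ext <;> simp
  rw [hsplit, map_add, map_smul, hy, map_smul]
  module

end Calculus

/-! ### §2 The momentum operator on the ansatz along the clock -/

section Momentum

variable {E : Type*} [NormedAddCommGroup E] [InnerProductSpace ℝ E] [FiniteDimensional ℝ E]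
variable {W : ℝ → E → E} {Q : ℝ → E → ℝ} {u : ℝ → E → E} {p : ℝ → E → ℝ} {ℓ θ : ℝ → ℝ}
  {ℓ' θ' σ : ℝ}

omit [FiniteDimensional ℝ E] in
/-- **Physical time derivative along the clock.** If `t ↦ u(t, x)` is differentiable at `θ(σ)`,
`θ′(σ) = θ' ≠ 0`, and along the clock, for similarity times NEAR `σ`, `u(θ(s), ·) = ℓ(s) • W(s, ℓ(s) •)`
with `W` jointly differentiable at `(σ, y)`, `y = ℓ(σ) x`, then
`∂ₜu(θ(σ), x) = θ'⁻¹ • (ℓ′ • (W(σ, y) + D_yW(σ, y) y) + ℓ(σ) • ∂_σW(σ, y))`. [folklore] -/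
theorem timeDeriv_along_clock (x : E) (hθ : HasDerivAt θ θ' σ) (hθ' : θ' ≠ 0) (hℓ : HasDerivAt ℓ ℓ' σ)
    (hW : DifferentiableAt ℝ (uncurry W) (σ, ℓ σ • x))
    (hans : ∀ᶠ s in 𝓝 σ, ∀ x, u (θ s) x = ℓ s • W s (ℓ s • x))
    (hu : DifferentiableAt ℝ (fun t => u t x) (θ σ)) :
    timeDeriv u (θ σ) x = θ'⁻¹ • (ℓ' • (W σ (ℓ σ • x) + fderiv ℝ (W σ) (ℓ σ • x) (ℓ σ • x)) +
      ℓ σ • deriv (fun s => W s (ℓ σ • x)) σ) := by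
  have hWL := hW.hasFDerivAt
  have h1 := hasDerivAt_modulatedProfile x hℓ hWL
  have h2 : HasDerivAt (fun s => u (θ s) x) (θ' • timeDeriv u (θ σ) x) σ := by
    have hu' : HasDerivAt (fun t => u t x) (timeDeriv u (θ σ) x) (θ σ) := by
      rw [timeDeriv_apply]; exact hu.hasDerivAt
    exact hu'.scomp σ hθ
  have h2' : HasDerivAt (fun s => ℓ s • W s (ℓ s • x)) (θ' • timeDeriv u (θ σ) x) σ :=
    h2.congr_of_eventuallyEq (hans.mono fun s hs => (hs x).symm)
  have huniq := h2'.unique h1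
  rw [fderiv_slice_space_apply hWL, (hasDerivAt_slice_time hWL).deriv, ← huniq, smul_smul,
    inv_mul_cancel₀ hθ', one_smul]

/-- **The momentum operator on the modulated ansatz with a similarity-time dependent profile.**
With `θ′(σ) = ℓ(σ)⁻²`, `ℓ(σ) ≠ 0`, `W` jointly differentiable on the slice `{σ} × E`, the ansatz along
the clock near `σ`, the pressure ansatz at `θ(σ)`, and `t ↦ u(t, x)` differentiable at `θ(σ)`: at
`y = ℓ(σ) x`,
`∂ₜu + (u·∇)u + ∇p − νΔu = (ℓ²ℓ′) • (W + D_yW y) + ℓ³ • (∂_σW + (W·∇)W + ∇Q − νΔW)` — every profile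
term carries `ℓ³`, the clock enters through `ℓ²ℓ′` only. [folklore] -/
theorem momentum_modulatedProfile (hθ : HasDerivAt θ ((ℓ σ ^ 2)⁻¹) σ) (hℓ : HasDerivAt ℓ ℓ' σ)
    (hℓ0 : ℓ σ ≠ 0) (hW : ∀ y, DifferentiableAt ℝ (uncurry W) (σ, y))
    (hans : ∀ᶠ s in 𝓝 σ, ∀ x, u (θ s) x = ℓ s • W s (ℓ s • x))
    (hp : p (θ σ) = fun x => ℓ σ ^ 2 * Q σ (ℓ σ • x))
    (hu : ∀ x, DifferentiableAt ℝ (fun t => u t x) (θ σ)) (ν : ℝ) (x : E) :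
    timeDeriv u (θ σ) x + convect (u (θ σ)) (u (θ σ)) x + gradient (p (θ σ)) x -
        ν • (Δ (u (θ σ))) x =
      (ℓ σ ^ 2 * ℓ') • (W σ (ℓ σ • x) + fderiv ℝ (W σ) (ℓ σ • x) (ℓ σ • x)) +
        ℓ σ ^ 3 • (deriv (fun s => W s (ℓ σ • x)) σ + convect (W σ) (W σ) (ℓ σ • x) +
          gradient (Q σ) (ℓ σ • x) - ν • (Δ (W σ)) (ℓ σ • x)) := by
  have hslice : u (θ σ) = nsRescaleData (ℓ σ) (W σ) := funext fun z => by
    rw [hans.self_of_nhds, nsRescaleData_apply]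
  have hinv : (ℓ σ ^ 2)⁻¹ ≠ 0 := inv_ne_zero (pow_ne_zero 2 hℓ0)
  rw [timeDeriv_along_clock x hθ hinv hℓ (hW _) hans (hu x), hslice, convect_nsRescaleData, hp,
    gradient_sq_mul_comp_smul, laplacian_nsRescaleData hℓ0, inv_inv]
  module

end Momentum

/-! ### §3 The momentum equation makes the readout periodic -/

section Rigidity

variable {E : Type*} [NormedAddCommGroup E] [InnerProductSpace ℝ E] [FiniteDimensional ℝ E]
variable {S : Set ℝ} {W : ℝ → E → E} {Q : ℝ → E → ℝ} {u : ℝ → E → E} {p : ℝ → E → ℝ}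
  {ℓ ℓ' θ : ℝ → ℝ} {ν P : ℝ}

/-! Standing hypotheses of §3: `S` is an OPEN set of similarity times on which the clock has `ℓ ≠ 0`
with derivative `ℓ′` and `θ′ = ℓ⁻²`; the profile `W` is jointly `C¹` and `P`-periodic in `σ`, the
similarity pressure `Q` is `P`-periodic; at the clock times `θ(σ)`, `σ ∈ S`, the physical fields are the
modulated ansatz, `t ↦ u(t, x)` is differentiable, and `∂ₜu + (u·∇)u + ∇p − νΔu = 0` (`ν : ℝ` arbitrary,
`0` allowed). Nothing is asked of `u` off the clock times `θ(S)`. -/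
variable (hS : IsOpen S) (hℓ : ∀ σ ∈ S, HasDerivAt ℓ (ℓ' σ) σ) (hℓ0 : ∀ σ ∈ S, ℓ σ ≠ 0)
  (hθ : ∀ σ ∈ S, HasDerivAt θ ((ℓ σ ^ 2)⁻¹) σ) (hW : ContDiff ℝ 1 (uncurry W))
  (hper : ∀ s, W (s + P) = W s) (hperQ : ∀ s, Q (s + P) = Q s)
  (hans : ∀ σ ∈ S, ∀ x, u (θ σ) x = ℓ σ • W σ (ℓ σ • x))
  (hp : ∀ σ ∈ S, p (θ σ) = fun x => ℓ σ ^ 2 * Q σ (ℓ σ • x))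
  (hu : ∀ σ ∈ S, ∀ x, DifferentiableAt ℝ (fun t => u t x) (θ σ))
  (heq : ∀ σ ∈ S, ∀ x : E,
    timeDeriv u (θ σ) x + convect (u (θ σ)) (u (θ σ)) x + gradient (p (θ σ)) x -
      ν • (Δ (u (θ σ))) x = 0)

include hS hℓ hℓ0 hθ hW hans hp hu heq in
/-- **From the momentum equation to the two-term identity** at a similarity time `σ ∈ S`: for EVERY
`y ∈ E`, `(ℓ²ℓ′)(σ) • (W + D_yW y)(σ, y) + ℓ(σ)³ • (∂_σW + (W·∇)W + ∇Q − νΔW)(σ, y) = 0`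
(evaluate `momentum_modulatedProfile` at `x = ℓ(σ)⁻¹ y`). [folklore] -/
theorem twoTerm_of_momentum_profile {σ : ℝ} (hσ : σ ∈ S) (y : E) :
    (ℓ σ ^ 2 * ℓ' σ) • (W σ y + fderiv ℝ (W σ) y y) +
      ℓ σ ^ 3 • (deriv (fun s => W s y) σ + convect (W σ) (W σ) y + gradient (Q σ) y -
        ν • (Δ (W σ)) y) = 0 := by
  have hev : ∀ᶠ s in 𝓝 σ, ∀ x, u (θ s) x = ℓ s • W s (ℓ s • x) :=
    Filter.eventually_of_mem (hS.mem_nhds hσ) fun s hs => hans s hs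
  have hx := heq σ hσ ((ℓ σ)⁻¹ • y)
  rw [momentum_modulatedProfile (hθ σ hσ) (hℓ σ hσ) (hℓ0 σ hσ)
    (fun y => hW.differentiable one_ne_zero _) hev (hp σ hσ) (hu σ hσ) ν, smul_smul,
    mul_inv_cancel₀ (hℓ0 σ hσ), one_smul] at hx
  exact hx

omit [FiniteDimensional ℝ E] in
include hper in
/-- Periodicity of the profile passes to its similarity-time derivative:
`∂_σW(σ + P, y) = ∂_σW(σ, y)`. [folklore] -/
theorem deriv_slice_add_period (σ : ℝ) (y : E) :
    deriv (fun s => W s y) (σ + P) = deriv (fun s => W s y) σ := by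
  have hfun : (fun s => W (s + P) y) = fun s => W s y := funext fun s => by rw [hper]
  rw [← deriv_comp_add_const (fun s => W s y) P σ, hfun]

include hS hℓ hℓ0 hθ hW hper hperQ hans hp hu heq in
/-- **THE READOUT IS PERIODIC.** If the momentum equation holds at the similarity times `σ` and
`σ + P` (both in `S`) and the slice `W(σ, ·)` is not identically zero, then
`ℓ′(σ + P)/ℓ(σ + P) = ℓ′(σ)/ℓ(σ)`: the two-term identities at `σ` and `σ + P` share their profile
fields (periodicity), so the coefficient pairs `(ℓ²ℓ′, ℓ³)` are proportional. [folklore] -/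
theorem readout_add_period_eq {σ : ℝ} (hσ : σ ∈ S) (hσP : σ + P ∈ S) (hWσ : W σ ≠ 0) :
    ℓ' (σ + P) / ℓ (σ + P) = ℓ' σ / ℓ σ := by
  -- a point where the scaling generator does not vanish
  have hC1 : ContDiff ℝ 1 (W σ) := hW.comp (contDiff_prodMk_right σ)
  obtain ⟨y₀, hy₀⟩ : ∃ y₀, W σ y₀ + fderiv ℝ (W σ) y₀ y₀ ≠ 0 := by
    by_contra h
    push Not at h
    exact hWσ (eq_zero_of_scalingGenerator_eq_zero hC1 h)
  -- the two-term identity on the pair `{σ, σ + P}`, with the fields frozen at `σ`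
  have h2 : ∀ s ∈ ({σ, σ + P} : Set ℝ), ∀ y : E,
      (ℓ s ^ 2 * ℓ' s) • (W σ y + fderiv ℝ (W σ) y y) +
        ℓ s ^ 3 • (deriv (fun s => W s y) σ + convect (W σ) (W σ) y + gradient (Q σ) y -
          ν • (Δ (W σ)) y) = 0 := by
    intro s hs y
    rcases hs with rfl | rfl
    · exact twoTerm_of_momentum_profile hS hℓ hℓ0 hθ hW hans hp hu heq hσ y
    · have h := twoTerm_of_momentum_profile hS hℓ hℓ0 hθ hW hans hp hu heq hσP y
      rwa [deriv_slice_add_period hper, hper, hperQ] at h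
  have key := mul_eq_mul_of_twoTerm (f := fun s => ℓ s ^ 2 * ℓ' s) (g := fun s => ℓ s ^ 3) h2 hy₀
    (show σ ∈ ({σ, σ + P} : Set ℝ) by simp) (show σ + P ∈ ({σ, σ + P} : Set ℝ) by simp)
  -- `ℓ(σ)² ℓ′(σ) ℓ(σ+P)³ = ℓ(σ+P)² ℓ′(σ+P) ℓ(σ)³`
  have h0 := hℓ0 σ hσ
  have hP0 := hℓ0 (σ + P) hσP
  rw [div_eq_div_iff hP0 h0]
  have hne : ℓ σ ^ 2 * ℓ (σ + P) ^ 2 ≠ 0 := by positivity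
  refine mul_left_cancel₀ hne ?_
  linear_combination -key

end Rigidity

/-! ### §4 Headlines on an open half-line of similarity times -/

section Headline

variable {E : Type*} [NormedAddCommGroup E] [InnerProductSpace ℝ E] [FiniteDimensional ℝ E]
variable {W : ℝ → E → E} {Q : ℝ → E → ℝ} {u : ℝ → E → E} {p : ℝ → E → ℝ}
  {ℓ ℓ' θ : ℝ → ℝ} {ν P σ₀ T : ℝ}

/-! Standing hypotheses of §4: those of §3 on the open half-line `S = (σ₀, ∞)`, plus `P > 0`, `ℓ > 0`,
and non-triviality of every slice, `W(σ, ·) ≢ 0` for `σ > σ₀`. -/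
variable (hP : 0 < P) (hℓ : ∀ σ, σ₀ < σ → HasDerivAt ℓ (ℓ' σ) σ) (hpos : ∀ σ, σ₀ < σ → 0 < ℓ σ)
  (hθ : ∀ σ, σ₀ < σ → HasDerivAt θ ((ℓ σ ^ 2)⁻¹) σ) (hW : ContDiff ℝ 1 (uncurry W))
  (hper : ∀ s, W (s + P) = W s) (hperQ : ∀ s, Q (s + P) = Q s)
  (hW0 : ∀ σ, σ₀ < σ → W σ ≠ 0)
  (hans : ∀ σ, σ₀ < σ → ∀ x, u (θ σ) x = ℓ σ • W σ (ℓ σ • x))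
  (hp : ∀ σ, σ₀ < σ → p (θ σ) = fun x => ℓ σ ^ 2 * Q σ (ℓ σ • x))
  (hu : ∀ σ, σ₀ < σ → ∀ x, DifferentiableAt ℝ (fun t => u t x) (θ σ))
  (heq : ∀ σ, σ₀ < σ → ∀ x : E,
    timeDeriv u (θ σ) x + convect (u (θ σ)) (u (θ σ)) x + gradient (p (θ σ)) x -
      ν • (Δ (u (θ σ))) x = 0)
include hP hℓ hpos hθ hW hper hperQ hW0 hans hp hu heq

/-- **Periodic readout on the half-line**: `ℓ′(σ + P)/ℓ(σ + P) = ℓ′(σ)/ℓ(σ)` for every `σ > σ₀`. [folklore] -/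
theorem periodicProfile_readout_periodic {σ : ℝ} (hσ : σ₀ < σ) :
    ℓ' (σ + P) / ℓ (σ + P) = ℓ' σ / ℓ σ :=
  readout_add_period_eq (S := Ioi σ₀) isOpen_Ioi (fun s hs => hℓ s hs) (fun s hs => (hpos s hs).ne')
    (fun s hs => hθ s hs) hW hper hperQ (fun s hs => hans s hs) (fun s hs => hp s hs)
    (fun s hs => hu s hs) (fun s hs => heq s hs) hσ
    (show σ + P ∈ Ioi σ₀ by simp only [mem_Ioi]; linarith) (hW0 σ hσ)

/-- **ONE SCALE FACTOR AND THE COVARIANCE ALONG THE CLOCK.** There is `c > 0` with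
`ℓ(σ + P) = c ℓ(σ)` and `u(θ(σ + P), x) = c • u(θ(σ), c • x)` for all `σ > σ₀`, `x` — the field one
period later is the `c`-rescaled field (any branch: `c > 1` backward DSS, `c = 1` time-periodic,
`c < 1` forward DSS). [folklore] -/
theorem periodicProfile_scaleFactor :
    ∃ c : ℝ, 0 < c ∧ (∀ σ, σ₀ < σ → ℓ (σ + P) = c * ℓ σ) ∧
      ∀ σ, σ₀ < σ → ∀ x : E, u (θ (σ + P)) x = c • u (θ σ) (c • x) := by
  have hb : ∀ σ, σ₀ < σ → ℓ' (σ + P) / ℓ (σ + P) = ℓ' σ / ℓ σ := fun σ hσ =>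
    periodicProfile_readout_periodic hP hℓ hpos hθ hW hper hperQ hW0 hans hp hu heq hσ
  -- the period ratio is the same at every `σ > σ₀`: compare both with the base point `min σ (σ₀ + 1)`
  have hratio : ∀ σ, σ₀ < σ → ℓ (σ + P) / ℓ σ = ℓ (σ₀ + 1 + P) / ℓ (σ₀ + 1) := by
    intro σ hσ
    have hb0 : σ₀ < min σ (σ₀ + 1) := lt_min hσ (by linarith)
    have e := fun s (hs : min σ (σ₀ + 1) ≤ s) =>
      periodRatio_eq (σ₀ := min σ (σ₀ + 1)) hP.le (fun s hs => hℓ s (lt_of_lt_of_le hb0 hs))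
        (fun s hs => (hpos s (lt_of_lt_of_le hb0 hs)).ne') (fun s hs => hb s (lt_of_lt_of_le hb0 hs)) hs
    rw [e σ (min_le_left _ _), e (σ₀ + 1) (min_le_right _ _)]
  refine ⟨ℓ (σ₀ + 1 + P) / ℓ (σ₀ + 1), div_pos (hpos _ (by linarith)) (hpos _ (by linarith)),
    fun σ hσ => ?_, fun σ hσ x => ?_⟩
  · rw [← hratio σ hσ, div_mul_cancel₀ _ (hpos σ hσ).ne']
  · have hcσ : ℓ (σ + P) = ℓ (σ₀ + 1 + P) / ℓ (σ₀ + 1) * ℓ σ := by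
      rw [← hratio σ hσ, div_mul_cancel₀ _ (hpos σ hσ).ne']
    rw [hans (σ + P) (by linarith), hans σ hσ, hper, hcσ]
    simp only [smul_smul]
    rw [mul_comm (ℓ σ) (ℓ (σ₀ + 1 + P) / ℓ (σ₀ + 1))]

/-- **BLOW-UP RIGIDITY OF AN EXACTLY DISCRETELY SELF-SIMILAR OBJECT IN AN ARBITRARY CLOCK.** If the
physical time of the clock is bounded, `θ(σ) → T` as `σ → ∞`, then there is `c > 1` with:
`ℓ(σ + P) = c ℓ(σ)`; `T − θ(σ + P) = (T − θ(σ))/c²`; `θ(σ) < T`; the PARABOLIC discrete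
self-similarity `u(T − (T − θ(σ))/c², x) = c • u(θ(σ), c • x)`; and constants `0 < m ≤ M` with
`m ≤ (T − θ(σ)) ℓ(σ)² ≤ M` — all for every `σ > σ₀`. The clock is Leray's `(T − t)^{-1/2}` up to a
bounded factor periodic in similarity time: no logarithmic (or any secular) correction. [folklore] -/
theorem periodicProfile_blowup_rigidity (hT : Tendsto θ atTop (𝓝 T)) :
    ∃ c : ℝ, 1 < c ∧ (∀ σ, σ₀ < σ → ℓ (σ + P) = c * ℓ σ) ∧
      (∀ σ, σ₀ < σ → T - θ (σ + P) = (T - θ σ) / c ^ 2) ∧ (∀ σ, σ₀ < σ → θ σ < T) ∧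
      (∀ σ, σ₀ < σ → ∀ x : E, u (T - (T - θ σ) / c ^ 2) x = c • u (θ σ) (c • x)) ∧
      ∃ m M : ℝ, 0 < m ∧ m ≤ M ∧
        ∀ σ, σ₀ < σ → m ≤ (T - θ σ) * ℓ σ ^ 2 ∧ (T - θ σ) * ℓ σ ^ 2 ≤ M := by
  obtain ⟨c, hc, hcl, hcov⟩ :=
    periodicProfile_scaleFactor hP hℓ hpos hθ hW hper hperQ hW0 hans hp hu heq
  -- the clock hypotheses restricted to a closed half-line `[σ, ∞)`, `σ > σ₀`
  have hθr : ∀ σ, σ₀ < σ → ∀ s, σ ≤ s → HasDerivAt θ ((ℓ s ^ 2)⁻¹) s :=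
    fun σ hσ s hs => hθ s (lt_of_lt_of_le hσ hs)
  have hner : ∀ σ, σ₀ < σ → ∀ s, σ ≤ s → ℓ s ≠ 0 :=
    fun σ hσ s hs => (hpos s (lt_of_lt_of_le hσ hs)).ne'
  have hclr : ∀ σ, σ₀ < σ → ∀ s, σ ≤ s → ℓ (s + P) = c * ℓ s :=
    fun σ hσ s hs => hcl s (lt_of_lt_of_le hσ hs)
  have hfix : ∀ σ, σ₀ < σ → T - θ (σ + P) = (T - θ σ) / c ^ 2 := by
    intro σ hσ
    obtain ⟨d, hd⟩ := exists_periodShift hP.le (hθr σ hσ) (hner σ hσ) hc.ne' (hclr σ hσ)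
    exact periodShift_eq_of_tendsto hd hT le_rfl
  have hmono : ∀ σ, σ₀ < σ → StrictMonoOn θ (Ici σ) :=
    fun σ hσ => strictMonoOn_time (hθr σ hσ) (hner σ hσ)
  have hlt : ∀ σ, σ₀ < σ → θ σ < T := fun σ hσ => time_lt_blowupTime hP (hmono σ hσ) hT le_rfl
  have hc1 : 1 < c := by
    have h1 : σ₀ < σ₀ + 1 := lt_add_one σ₀
    obtain ⟨d, hd⟩ := exists_periodShift hP.le (hθr _ h1) (hner _ h1) hc.ne' (hclr _ h1)
    exact one_lt_scaleFactor hP (hmono _ h1) hc hd hT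
  -- bounds on `[σ₀ + P, ∞)`, transported one period back to cover `(σ₀, σ₀ + P)`
  have hP1 : σ₀ < σ₀ + P := by linarith
  obtain ⟨m, M, hm, hmM, hbd⟩ := exists_bounds_sub_time_mul_sq (σ₀ := σ₀ + P) hP hc
    (fun s hs => (hℓ s (lt_of_lt_of_le hP1 hs)).differentiableAt)
    (fun s hs => hpos s (lt_of_lt_of_le hP1 hs)) (hθr _ hP1) (hclr _ hP1)
    (fun s hs => hfix s (lt_of_lt_of_le hP1 hs)) (fun s hs => hlt s (lt_of_lt_of_le hP1 hs))
  refine ⟨c, hc1, hcl, hfix, hlt, fun σ hσ x => ?_, m, M, hm, hmM, fun σ hσ => ?_⟩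
  · have ht : T - (T - θ σ) / c ^ 2 = θ (σ + P) := by linarith [hfix σ hσ]
    rw [ht, hcov σ hσ x]
  · by_cases h : σ₀ + P ≤ σ
    · exact hbd σ h
    · have h2 := hbd (σ + P) (by linarith)
      rwa [sub_time_mul_sq_add_period hc.ne' (hcl σ hσ) (hfix σ hσ)] at h2

/-- **In the tree's DSS vocabulary** (blow-up time normalised to `T = 0`): there is `c > 1` with
`nsRescale c u t = u t` at every clock time `t = θ(σ)`, `σ > σ₀ + P` — the field is `c`-discretely
self-similar on the clock's range (compare `Literature.Analysis.FluidPDE.periodic_lerayOrbit_iff`: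
in LERAY's similarity time the profile is then `2 log c`-periodic). [folklore] -/
theorem periodicProfile_nsRescale_eq (hT : Tendsto θ atTop (𝓝 0)) :
    ∃ c : ℝ, 1 < c ∧ ∀ σ, σ₀ + P < σ → nsRescale c u (θ σ) = u (θ σ) := by
  obtain ⟨c, hc, -, hfix, -, hcov, -⟩ :=
    periodicProfile_blowup_rigidity hP hℓ hpos hθ hW hper hperQ hW0 hans hp hu heq hT
  refine ⟨c, hc, fun σ hσ => funext fun x => ?_⟩
  have hs : σ₀ < σ - P := by linarith
  have h1 : θ σ = θ (σ - P) / c ^ 2 := by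
    have := hfix (σ - P) hs
    rw [sub_add_cancel, zero_sub, zero_sub, neg_div, neg_inj] at this
    exact this
  have h2 := hcov (σ - P) hs x
  rw [zero_sub, zero_sub, neg_div, neg_neg] at h2
  have hc2 : c ^ 2 ≠ 0 := by positivity
  rw [nsRescale_apply, h1, mul_div_cancel₀ _ hc2, ← h2]

end Headline

end Summit.NavierStokesRegularity.FluidComputer.SelfSimilarCensus

end
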